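import Literature.MathematicalPhysics.QuantumFieldTheory.Balaban1983to89.B9RWSums346Two
import Literature.MathematicalPhysics.QuantumFieldTheory.Balaban1983to89.B9RWSumsReadsNbr

/-!
# `Balaban1983to89.B9RWSums346SecondDiff` — [B9] the PRINTED second-order L² members of (3.46) for the random-walk sum (3.107) G(U):
# ‖h∇_U∇_UG(U)J‖ and ‖hG(U)∇\*_U∇\*_UJ‖, DIRECTION-PAIR INDEXED, at one member and one configuration — L² block bounds from
# operator-level hypothesis schemas of printed shape, and the pair family packaged as ONE model on a product lattice

T. Bałaban, *Propagators for lattice gauge theories in a background field*, Commun. Math. Phys. **99** (1985) 389–434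
[`Balaban1985BackgroundPropagators`, "B9"]; [4] = T. Bałaban, *Propagators and renormalization transformations for lattice
gauge theories. II*, Commun. Math. Phys. **96** (1984) 223–250 [`Balaban1984PropagatorsII`].

statement-level skeleton of published theorems with citation tags; proofs where landed; nothing here is a claim about the
Yang–Mills mass gap

THE PRINTED LOCI (verbatim, lit-balaban desk reading of the ×2 renders of p. 398, pub-ymgap INBOX 2026-08-27).  (3.46), p. 398
ll. 19–22: *"Finally, we have the inequalities in L²-norms ‖hG′(U)λ‖, ‖h∇_UG′(U)λ‖, ‖hG′(U)∇\*_Uλ‖, ‖h∇_U∇_UG′(U)λ‖, ‖h∇_UG′(U)∇\*_Uλ‖,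
‖hG′(U)∇\*_U∇\*_Uλ‖ ≦ B₀[(Lʲη)², Lʲη, Lʲη, 1, 1, 1]|h|e^{−δ₀d(y,y′)}‖λ‖ for supp h ⊂ Δ(y), y ∈ Λ_j, supp λ ⊂ Δ(y′)"*; p. 398 ll. 28–31:
*"the choice of derivatives ∇_U, ∇\*_U is conventional, we may always replace ∇_U by ∇\*_U, and vice versa, in arbitrary place and
combination"*; (3.39) p. 397: *"|∇A| = max_{μ,ν} sup |(D_μA_ν)(x)|"* (the derivative index is independent of the component index);
(3.106) p. 414: *"G = G₀(I − R)⁻¹"*; p. 413: *"An operator R_α(X) … satisfies a bound of the type (3.89), possibly with an additional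
power of Lʲη"*; p. 391: ∇\* is the L² adjoint of ∇; Theorem 3.10 p. 416: *"convergent in all norms in the inequalities (3.42)–(3.47)."*

WHY THIS FILE.  The leaves of this lineage (`B9RWSums346Lap`, `…AllBlocks*`) model the weight-1 L² lines n = 3, 5 of `B9.KernelFamily.l2`
by the LAPLACIAN composites `Lap ∘ₗ G`, `G ∘ₗ Lap` — trace consequences, NOT the printed members, which are the direction-PAIR families
∇_ν∇_μG and G∇\*_ν∇\*_μ (def-Y's `Node00.kernelFamilyB.l2 3∕4∕5` take `sup` over the pair); and a one-slot coordinate model realises only the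
diagonal pairs (this seat's located points (O3)∕(O4), decided for option (b) by the lit-balaban desk answer of record).  THIS FILE supplies
the print-faithful operator-level layer for the sum G(U) of (3.107):

* §1 ★ `familyOp` — a family `T p : (v → ℝ) →ₗ (u → ℝ)`, `p : P`, packaged as ONE linear map into the product lattice `u × P`
  (`(familyOp T f) (x, p) = T p f x`), with `bsq_familyOp` ∕ ★ `blockBd_familyOp` (∀ p, block bound K ⇒ block bound √|P|·K for the
  package): a member that is a `sup` over pairs is then co-read (`B9RWSumsReadsNbr.L2ReadsNbr … (bu ∘ Prod.fst) bv ev (familyOp T)`) from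
  bounds on EVERY pair's honest one-slot model — no two-slot carrier.
* §2 ★ `comp_l2_transfer` — `B9RWSums346Two.tail_comp_l2` with a REAL scale power q, |q| ≦ 4: S with block bound C·(Lʲη)^q·e^{−ρd} after
  P with block bound θ·(Lʲη)^{−q}·e^{−δ₁d} has block bound C·θ·L₀^{|q|}·c₁(α₁)·e^{−ρ′d} (ρ = αδ + ρ′; p. 398 transfer + [4] (2.61)).
* §3 letters ★ `DirOps310 𝔬 P` (the covariant differences ∇_{U,μ}, ∇\*_{U,μ} in a FIXED direction μ ∈ P as operators on the G-lattice X)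
  and hypothesis schemas of printed shape: `DirTranspose310` (∇\*_μ = ∇_μᵀ, p. 391), `L2SecondLegs310` (Cor. 3.6's line ‖hG_□∇\*∇\*λ‖ for
  the head terms h_□G_□h_□, localized, POSITED as a whole), `FactorsL2Second310` (R_a∇\*_ν∇\*_μ in block-L² norms with the power
  (Lʲη)^{−2}, p. 413, POSITED), the constant `secondConst`.
* §4 ★ `l2line5_of_local310` — ∀ ν μ, the L² block bound of G∇\*_ν∇\*_μ: from (3.106) read as G = G₀ + G·R (`fixedPoint_of_388`, NO
  fixed point in the unknown), the head legs summed, the sibling's Schur block bound of G (`B9RWSums346Schur.blockBd_entry0`), the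
  factors summed, and `comp_l2_transfer` at q = 2; ★ `l2line3_of_local310` — ∀ ν μ, the L² block bound of ∇_ν∇_μG = (G∇\*_μ∇\*_ν)ᵀ by
  r1's adjoint transfer `B9SectDL2Decay.blockBd_of_adjoint` (G symmetric, ∇\* = ∇ᵀ); ★ `blockBd_second_family3∕5` — the two pair
  families packaged by `familyOp` over `P × P`.

HONEST SCOPE.  Nothing of print is asserted: the legs, the factor bounds and the transpose letters are hypotheses of printed shape; the
file is kernel bookkeeping over them.  The G′ side (Theorem 3.7) and the v3 leaves that swap the lineage's `hl3`∕`hl5` binders to these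
families are sequels.  NOT a node discharge; count-neutral; one finite 𝕋^{d+1} programme at fixed ε — nothing continuum, nothing about
the mass gap.  Cell `pub-ymgap` (HUMAN RULING D-0062), Track A node N06 [B9], N06-ASSIGNMENT v1 bundle F6 (rows 18–19), seat
`pub-ymgap-dag-n06-k` (gen 8), 2026-08-27.
-/

namespace Literature.MathematicalPhysics.QuantumFieldTheory.Balaban1983to89.B9RWSums346SecondDiff

open Literature.MathematicalPhysics.QuantumFieldTheory.Balaban1983to89
open Finset B6RandomWalk B6RandomWalkHom B9Thm37Sum B9Thm34Ext B9Thm37Glue B9Thm37Whole B9Cor38Whole B9Thm310Whole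
open B9RWSums343to347Whole B9RWSums346Schur B9Thm37GlueCor36 B9RWSums343Holder B9RWSums346Lap B9RWSums344Input B9RWSums346Two
open B11SectG B9Thm37AllNorms B9SectDL2Decay B9Ineq347 B9Ineq347AllEntries

noncomputable section

/-! ## §1 A direction-pair family of model operators packaged as one model on the product lattice -/

section Family

variable {g : B9.Geometry} [Fintype g.Site] {R : ℝ} {H : Prop} {u v P : Type}

/-- ★ **A FAMILY OF LINEAR MODELS AS ONE LINEAR MODEL INTO THE PRODUCT LATTICE**: `(familyOp T f) (x, p) := T p f x` — the member
*"max_{μ,ν} …"* of (3.39)∕(3.46) is read from the product lattice `u × P` on which every pair's model is laid out side by side.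
[cite: Balaban1985BackgroundPropagators, (3.39) p.397 («max_{μ,ν}») + (3.46) p.398, dictionary] -/
def familyOp (T : P → ((v → ℝ) →ₗ[ℝ] (u → ℝ))) : (v → ℝ) →ₗ[ℝ] (u × P → ℝ) where
  toFun f := fun xp => T xp.2 f xp.1
  map_add' f f' := by
    funext xp
    simp only [map_add, Pi.add_apply]
  map_smul' c f := by
    funext xp
    simp only [map_smul, Pi.smul_apply, smul_eq_mul, RingHom.id_apply]

omit [Fintype g.Site] in
/-- `familyOp`, evaluated. [cite: Balaban1985BackgroundPropagators, (3.39) p.397, bookkeeping] -/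
@[simp] theorem familyOp_apply (T : P → ((v → ℝ) →ₗ[ℝ] (u → ℝ))) (f : v → ℝ) (x : u) (p : P) :
    familyOp T f (x, p) = T p f x := rfl

/-- the block square-size of the package over the fibre of y is the SUM over the family of the block square-sizes.
[cite: Balaban1985BackgroundPropagators, (3.46) p.398, bookkeeping] -/
theorem bsq_familyOp [Fintype u] [Fintype P] (bu : u → g.Site) (T : P → ((v → ℝ) →ₗ[ℝ] (u → ℝ))) (f : v → ℝ) (y : g.Site) :
    bsq (g := toB6 g R H) (bu ∘ Prod.fst) y (familyOp T f) = ∑ p, bsq (g := toB6 g R H) bu y (T p f) := by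
  classical
  unfold bsq
  rw [Fintype.sum_prod_type, Finset.sum_comm]
  rfl

/-- ★ **THE PACKAGE OF A FAMILY OF BLOCK-BOUNDED MODELS IS BLOCK-BOUNDED** with the constant √|P|: if every `T p` has the L² block
bound K ≧ 0 between the fibres of `bv` and `bu`, then `familyOp T` has the block bound √|P|·K between the fibres of `bv` and `bu ∘ fst`.
[cite: Balaban1985BackgroundPropagators, (3.46) p.398 + (3.39) p.397, bookkeeping] -/
theorem blockBd_familyOp [Fintype u] [Fintype v] [Fintype P] (bv : v → g.Site) (bu : u → g.Site)
    {T : P → ((v → ℝ) →ₗ[ℝ] (u → ℝ))} {K : g.Site → g.Site → ℝ} (hK : ∀ a b, 0 ≤ K a b)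
    (h : ∀ p, BlockBd (g := toB6 g R H) bv bu (T p) K) :
    BlockBd (g := toB6 g R H) bv (bu ∘ Prod.fst) (familyOp T)
      (fun a b => Real.sqrt (Fintype.card P) * K a b) := by
  intro y' μ hμ y
  have hB : 0 ≤ K y y' * bl2 (g := toB6 g R H) bv y' μ := mul_nonneg (hK y y') (bl2_nonneg _ _ _)
  have hp : ∀ p, bsq (g := toB6 g R H) bu y (T p μ) ≤ (K y y' * bl2 (g := toB6 g R H) bv y' μ) ^ 2 := by
    intro p
    rw [← bl2_sq]
    exact pow_le_pow_left₀ (bl2_nonneg _ _ _) (h p y' μ hμ y) 2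
  have hsum : bsq (g := toB6 g R H) (bu ∘ Prod.fst) y (familyOp T μ) ≤
      (Fintype.card P : ℝ) * (K y y' * bl2 (g := toB6 g R H) bv y' μ) ^ 2 := by
    rw [bsq_familyOp]
    calc ∑ p, bsq (g := toB6 g R H) bu y (T p μ) ≤ ∑ _p : P, (K y y' * bl2 (g := toB6 g R H) bv y' μ) ^ 2 :=
          Finset.sum_le_sum fun p _ => hp p
      _ = (Fintype.card P : ℝ) * (K y y' * bl2 (g := toB6 g R H) bv y' μ) ^ 2 := by
          rw [Finset.sum_const, Finset.card_univ, nsmul_eq_mul]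
  unfold bl2
  calc Real.sqrt (bsq (g := toB6 g R H) (bu ∘ Prod.fst) y (familyOp T μ))
      ≤ Real.sqrt ((Fintype.card P : ℝ) * (K y y' * bl2 (g := toB6 g R H) bv y' μ) ^ 2) := Real.sqrt_le_sqrt hsum
    _ = Real.sqrt (Fintype.card P) * (K y y' * bl2 (g := toB6 g R H) bv y' μ) := by
        rw [Real.sqrt_mul (Nat.cast_nonneg _), Real.sqrt_sq hB]
    _ = Real.sqrt (Fintype.card P) * K y y' * Real.sqrt (bsq (g := toB6 g R H) bv y' μ) := by
        unfold bl2; ring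

end Family

/-! ## §2 The composition with a real scale power: the p. 398 transfer and [4] (2.61) in block-L² norms -/

section Transfer

variable {g : B9.Geometry} [Fintype g.Site] {R : ℝ} {H : Prop} {X Y Z : Type} [Fintype X] [Fintype Y] [Fintype Z]

/-- ★ **THE TAIL COMPOSITION IN BLOCK-L² NORMS WITH A REAL SCALE POWER** (`B9RWSums346Two.tail_comp_l2` is q = 1): S with the L² block
bound C·(Lʲη)^q·e^{−ρd} after P with the L² block bound θ·(Lʲη)^{−q}·e^{−δ₁d} has the L² block bound C·θ·L₀^{|q|}·c₁(α₁)·e^{−ρ′d(y,y′)} for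
ρ = αδ + ρ′, 0 ≦ ρ′ ≦ (1 − α₁)δ₁, |q| ≦ 4 — `B11SectG.hasMaj_comp` between the `l2w` norms, the transfer (Lʲη)^q(L^{j″}η)^{−q}e^{−αδd(y,y″)} ≦
L^{|q|} ≦ L₀^{|q|} (p. 398 remark, `B9RWSums346Schur.scaleTransfer_len_rpow` under the size condition of `Facts347`) and [4] (2.61) at (δ₁, α₁).
[cite: Balaban1985BackgroundPropagators, (3.46) p.398 + remark after (3.47) p.398 + p.413; Balaban1984PropagatorsII, (2.52)–(2.55) p.232 + Lemma 2.1 (2.60)–(2.61) p.234] -/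
theorem comp_l2_transfer (blk : X → g.Site) (blkY : Y → g.Site) (blkZ : Z → g.Site) {S : (X → ℝ) →ₗ[ℝ] (Z → ℝ)}
    {P : (Y → ℝ) →ₗ[ℝ] (X → ℝ)} {d d₁ : ℕ} {δ α L₀ δ₁ α₁ C θ ρ ρ' q : ℝ} (hF : Facts347 g R H d δ α L₀)
    (h261 : Ineq261 d₁ (toB6 g R H) δ₁ α₁) (htri : Triangle254 (toB6 g R H))
    (hsymm : ∀ y y' : g.Site, g.dist y y' = g.dist y' y) (hdnn : ∀ y y' : g.Site, 0 ≤ g.dist y y')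
    (hlen : ∀ y : g.Site, 0 < g.len y) (hC : 0 ≤ C) (hθ : 0 ≤ θ) (hρ : ρ = α * δ + ρ') (hρ' : 0 ≤ ρ')
    (hrate : ρ' ≤ (1 - α₁) * δ₁) (hq : |q| ≤ 4)
    (hS : BlockBd (g := toB6 g R H) blk blkZ S (fun (a b : g.Site) => C * g.len a ^ q * Real.exp (-(ρ * g.dist a b))))
    (hP : BlockBd (g := toB6 g R H) blkY blk P
      (fun (y y' : g.Site) => θ * g.len y ^ (-q) * Real.exp (-(δ₁ * g.dist y y')))) :
    BlockBd (g := toB6 g R H) blkY blkZ (S ∘ₗ P)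
      (fun (a b : g.Site) => C * θ * L₀ ^ |q| * B6.c1 d₁ δ₁ α₁ * Real.exp (-(ρ' * g.dist a b))) := by
  -- adapted from `B9RWSums346Two.tail_comp_l2` (q = 1)
  have hlen0 : ∀ y : g.Site, 0 ≤ g.len y := fun y => (hlen y).le
  have hL1 : 1 ≤ g.L := hF.one_le_L
  have hL0 : 0 ≤ g.L := zero_le_one.trans hL1
  have hL₀ : 0 ≤ L₀ := hL0.trans hF.L_le
  have hK : ∀ a b : g.Site, 0 ≤ C * g.len a ^ q * Real.exp (-(ρ * g.dist a b)) := fun a b =>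
    mul_nonneg (mul_nonneg hC (Real.rpow_nonneg (hlen0 a) _)) (Real.exp_nonneg _)
  have hS' := (blockBd_iff_hasMaj (g := toB6 g R H) blk blkZ S _).mp hS
  have hP' := (blockBd_iff_hasMaj (g := toB6 g R H) blkY blk P _).mp hP
  have hcomp := hasMaj_comp hS' hP' hK
  rw [blockBd_iff_hasMaj]
  refine hcomp.mono fun a b => ?_
  rw [l2w_κ]
  -- the transfer: (Lʲη)^q (L^{j″}η)^{−q} e^{−ρd(y,y″)} ≤ L₀^{|q|} e^{−ρ′d(y,y″)}
  have htransfer : ∀ z : g.Site, g.len a ^ q * g.len z ^ (-q) * Real.exp (-(ρ * g.dist a z)) ≤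
      L₀ ^ |q| * Real.exp (-(ρ' * g.dist a z)) := by
    intro z
    have hst : Real.exp (-(α * δ * g.dist a z)) * g.len z ^ (-q) ≤ g.L ^ |(-q)| * g.len a ^ (-q) :=
      scaleTransfer_len_rpow hF (-q) (by rw [abs_neg]; exact hq) a z
    rw [abs_neg] at hst
    have hsplit : Real.exp (-(ρ * g.dist a z)) = Real.exp (-(α * δ * g.dist a z)) * Real.exp (-(ρ' * g.dist a z)) := by
      rw [← Real.exp_add, hρ]; congr 1; ring
    have hcancel : g.len a ^ q * g.len a ^ (-q) = 1 := by
      rw [Real.rpow_neg (hlen0 a), mul_inv_cancel₀ (Real.rpow_pos_of_pos (hlen a) q).ne']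
    have hkey : g.len a ^ q * g.len z ^ (-q) * Real.exp (-(α * δ * g.dist a z)) ≤ L₀ ^ |q| := by
      have h1 : g.len a ^ q * (Real.exp (-(α * δ * g.dist a z)) * g.len z ^ (-q)) ≤ g.len a ^ q * (g.L ^ |q| * g.len a ^ (-q)) :=
        mul_le_mul_of_nonneg_left hst (Real.rpow_nonneg (hlen0 a) _)
      have h2 : g.len a ^ q * (g.L ^ |q| * g.len a ^ (-q)) = g.L ^ |q| := by
        calc g.len a ^ q * (g.L ^ |q| * g.len a ^ (-q)) = g.L ^ |q| * (g.len a ^ q * g.len a ^ (-q)) := by ring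
          _ = g.L ^ |q| := by rw [hcancel, mul_one]
      calc g.len a ^ q * g.len z ^ (-q) * Real.exp (-(α * δ * g.dist a z))
          = g.len a ^ q * (Real.exp (-(α * δ * g.dist a z)) * g.len z ^ (-q)) := by ring
        _ ≤ g.L ^ |q| := by rw [← h2]; exact h1
        _ ≤ L₀ ^ |q| := Real.rpow_le_rpow hL0 hF.L_le (abs_nonneg q)
    rw [hsplit]
    calc g.len a ^ q * g.len z ^ (-q) * (Real.exp (-(α * δ * g.dist a z)) * Real.exp (-(ρ' * g.dist a z)))
        = (g.len a ^ q * g.len z ^ (-q) * Real.exp (-(α * δ * g.dist a z))) * Real.exp (-(ρ' * g.dist a z)) := by ring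
      _ ≤ L₀ ^ |q| * Real.exp (-(ρ' * g.dist a z)) := mul_le_mul_of_nonneg_right hkey (Real.exp_nonneg _)
  -- the convolution at (δ₁, α₁)
  have hconv : ∑ z : g.Site, Real.exp (-(ρ' * g.dist a z)) * Real.exp (-(δ₁ * g.dist z b)) ≤
      B6.c1 d₁ δ₁ α₁ * Real.exp (-(ρ' * g.dist a b)) := by
    have h := conv_exp_le_of_261 (R := R) (H := H) d₁ δ₁ α₁ ρ' hρ' hrate htri hdnn h261 b a
    have hrw : ∀ z : g.Site, Real.exp (-(ρ' * g.dist a z)) * Real.exp (-(δ₁ * g.dist z b)) =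
        Real.exp (-(δ₁ * g.dist b z)) * Real.exp (-(ρ' * g.dist z a)) := by
      intro z; rw [hsymm a z, hsymm z b, mul_comm]
    rw [Finset.sum_congr rfl fun z _ => hrw z, hsymm a b]
    exact h
  have hL₀q : 0 ≤ L₀ ^ |q| := Real.rpow_nonneg hL₀ _
  calc (∑ z : g.Site, C * g.len a ^ q * Real.exp (-(ρ * (toB6 g R H).dist a z)) *
          (1 * (θ * g.len z ^ (-q) * Real.exp (-(δ₁ * (toB6 g R H).dist z b)))))
      = C * θ * ∑ z : g.Site, (g.len a ^ q * g.len z ^ (-q) * Real.exp (-(ρ * g.dist a z))) *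
          Real.exp (-(δ₁ * g.dist z b)) := by
        simp only [toB6_dist]
        rw [Finset.mul_sum]
        exact Finset.sum_congr rfl fun z _ => by ring
    _ ≤ C * θ * ∑ z : g.Site, (L₀ ^ |q| * Real.exp (-(ρ' * g.dist a z))) * Real.exp (-(δ₁ * g.dist z b)) := by
        refine mul_le_mul_of_nonneg_left (Finset.sum_le_sum fun z _ => ?_) (mul_nonneg hC hθ)
        exact mul_le_mul_of_nonneg_right (htransfer z) (Real.exp_nonneg _)
    _ = C * θ * L₀ ^ |q| * ∑ z : g.Site, Real.exp (-(ρ' * g.dist a z)) * Real.exp (-(δ₁ * g.dist z b)) := by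
        rw [Finset.mul_sum, Finset.mul_sum]
        exact Finset.sum_congr rfl fun z _ => by ring
    _ ≤ C * θ * L₀ ^ |q| * (B6.c1 d₁ δ₁ α₁ * Real.exp (-(ρ' * g.dist a b))) :=
        mul_le_mul_of_nonneg_left hconv (mul_nonneg (mul_nonneg hC hθ) hL₀q)
    _ = C * θ * L₀ ^ |q| * B6.c1 d₁ δ₁ α₁ * Real.exp (-(ρ' * g.dist a b)) := by ring

omit [Fintype X] [Fintype Y] [Fintype Z] in
/-- Algebra of (3.106) read through an operator on the right: G∘D = G₀∘D + G∘(W∘D) from G = G₀ + G·W. [folklore] -/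
private theorem right_split {Y' : Type} {Dst : (Y' → ℝ) →ₗ[ℝ] (X → ℝ)} {G G0 W : Module.End ℝ (X → ℝ)} (h : G = G0 + G * W) :
    G ∘ₗ Dst = G0 ∘ₗ Dst + G ∘ₗ (W ∘ₗ Dst) := by
  conv_lhs => rw [h]
  apply LinearMap.ext
  intro μ
  simp only [LinearMap.comp_apply, LinearMap.add_apply, Module.End.mul_apply]

/-- L² block bounds add. [folklore] -/
private theorem blockBd_add' (blk₁ : X → g.Site) (blk₂ : Z → g.Site) {T₁ T₂ : (X → ℝ) →ₗ[ℝ] (Z → ℝ)}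
    {K₁ K₂ : g.Site → g.Site → ℝ} (h₁ : BlockBd (g := toB6 g R H) blk₁ blk₂ T₁ K₁)
    (h₂ : BlockBd (g := toB6 g R H) blk₁ blk₂ T₂ K₂) :
    BlockBd (g := toB6 g R H) blk₁ blk₂ (T₁ + T₂) (fun a b => K₁ a b + K₂ a b) := by
  rw [blockBd_iff_hasMaj] at h₁ h₂ ⊢
  exact h₁.add h₂

end Transfer

/-! ## §3 The direction letters and the hypothesis schemas of printed shape for the second-order L² members -/

section Letters

variable {g : B9.Geometry} [Fintype g.Site] [DecidableEq g.Site] {R : ℝ} {H : Prop} {B : B9.Backgrounds}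
variable {X Y ι A : Type}

/-- ★ **THE DIRECTION LETTERS OF A WALK DATUM**: for each configuration U and each direction μ ∈ P the covariant differences ∇_{U,μ}
(`Dd U μ`) and ∇\*_{U,μ} (`Dsd U μ`) as ℝ-linear operators on the G-lattice X (print: the operators of (3.5)–(3.8) in a fixed direction;
the walk datum `Ops310` carries only the direction-bundled ∇_U : X → Y).  OURS (letters; at the record's coordinate pins `Dd U μ` is the
one-slot coordinate model of ∇_{U,μ}). [cite: Balaban1985BackgroundPropagators, (3.5)–(3.8) p.392 + (3.39) p.397 + (3.46) p.398] -/
structure DirOps310 (𝔬 : Ops310 g B X Y ι A) (P : Type) where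
  Dd : B.Cfg → P → Module.End ℝ (X → ℝ)
  Dsd : B.Cfg → P → Module.End ℝ (X → ℝ)

variable {P : Type}

/-- **∇\*_{U,μ} IS THE TRANSPOSE OF ∇_{U,μ}** w.r.t. the lattice pairing (p. 391: *"∇\*_U … the adjoint of ∇_U with respect to natural L²
scalar products"*).  A HYPOTHESIS SCHEMA (a letter, like the lineage's `IsTransposePair` binders); nothing asserted.
[cite: Balaban1985BackgroundPropagators, p.391 (L² adjoints) + (3.8) p.392] -/
structure DirTranspose310 [Fintype X] (𝔬 : Ops310 g B X Y ι A) (𝔡 : DirOps310 𝔬 P) (U : B.Cfg) : Prop where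
  tr : ∀ μ : P, IsTransposePair (𝔡.Dsd U μ) (𝔡.Dd U μ)

/-- **COROLLARY 3.6's SECOND-ORDER L² LINE ‖hG_□∇\*_U∇\*_Uλ‖ OF (3.46) FOR THE HEAD TERMS h_□G_□(U)h_□ OF (3.107), LOCALIZED, PER DIRECTION
PAIR**: (h_□G_□h_□)∇\*_{U,ν}∇\*_{U,μ} has the L² block bound 1_{S₃(□)}(y)·B₃·e^{−δ₀d(y,y′)}.  POSITED AS A WHOLE (incl. the product rules through
h_□); a HYPOTHESIS SCHEMA, Corollary 3.6 is not asserted. [cite: Balaban1985BackgroundPropagators, Cor. 3.6 p.408 + (3.46) p.398 (sixth member) + (3.100) p.413] -/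
structure L2SecondLegs310 [Fintype X] (𝔬 : Ops310 g B X Y ι A) (𝔡 : DirOps310 𝔬 P) (R : ℝ) (H : Prop) (S3 : ι → Finset g.Site)
    (B3 δ₀ : ℝ) (U : B.Cfg) : Prop where
  l5 : ∀ (i : ι) (ν μ : P), BlockBd (g := toB6 g R H) 𝔬.blk 𝔬.blk
    ((mulOp (𝔬.h i) * 𝔬.Gsq U i * mulOp (𝔬.h i)) ∘ₗ (𝔡.Dsd U ν ∘ₗ 𝔡.Dsd U μ))
    (fun (a b : g.Site) => (if a ∈ S3 i then (1 : ℝ) else 0) * (B3 * Real.exp (-(δ₀ * g.dist a b))))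

/-- **THE FACTORS R_a(U)∇\*_{U,ν}∇\*_{U,μ} IN THE BLOCK-L² NORMS** (p. 413, *"bound of the type (3.89), possibly with an additional power of Lʲη"*):
‖1_{Δ(y)}R_a∇\*_ν∇\*_μμ‖₂ ≦ 1_{X∩𝔅}(y)·θ₃M⁻¹·(Lʲη)⁻²·e^{−δ₀d(y,y′)}‖μ‖₂, supp μ ⊂ Δ(y′).  POSITED; a HYPOTHESIS SCHEMA.
[cite: Balaban1985BackgroundPropagators, p.413 + (3.105) p.414 + (3.46) p.398] -/
structure FactorsL2Second310 [Fintype X] (𝔬 : Ops310 g B X Y ι A) (𝔡 : DirOps310 𝔬 P) (R : ℝ) (H : Prop) (θ3 δ₀ : ℝ)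
    (U : B.Cfg) : Prop where
  facDD : ∀ (a : A) (ν μ : P), BlockBd (g := toB6 g R H) 𝔬.blk 𝔬.blk (𝔬.Rf U a ∘ₗ (𝔡.Dsd U ν ∘ₗ 𝔡.Dsd U μ))
    (fun (y y' : g.Site) => (if y ∈ 𝔬.SF a then (1 : ℝ) else 0) *
      (θ3 * g.M⁻¹ * g.len y ^ (-2 : ℝ) * Real.exp (-(δ₀ * g.dist y y'))))

/-- **The constant of the second-order L² lines of the sum**: N₃·B₃ + C·L₀·(N_F·θ₃)·L₀²·c₁(α₁) (head legs summed; the sibling's L² bound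
C·L₀·(Lʲη)² of G, the factors summed, the transfer at power 2, one convolution). [cite: Balaban1985BackgroundPropagators, (3.46) p.398 + Thm 3.10 p.416] -/
def secondConst (d₁ : ℕ) (δ₁ α₁ N3 B3 NF θ3 C L₀ : ℝ) : ℝ :=
  N3 * B3 + C * L₀ * (NF * θ3) * L₀ ^ (2 : ℝ) * B6.c1 d₁ δ₁ α₁

omit [Fintype g.Site] [DecidableEq g.Site] in
/-- `0 ≤ secondConst …` for non-negative data. [cite: Balaban1985BackgroundPropagators, (3.46) p.398, bookkeeping] -/
theorem secondConst_nonneg {d₁ : ℕ} {δ₁ α₁ N3 B3 NF θ3 C L₀ : ℝ} (hN3 : 0 ≤ N3) (hB3 : 0 ≤ B3) (hNF : 0 ≤ NF) (hθ3 : 0 ≤ θ3)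
    (hC : 0 ≤ C) (hL₀ : 0 ≤ L₀) : 0 ≤ secondConst d₁ δ₁ α₁ N3 B3 NF θ3 C L₀ := by
  have := c1_nonneg d₁ δ₁ α₁
  unfold secondConst
  positivity

end Letters

/-! ## §4 The sum G(U) of (3.107): the second-order L² block bounds per direction pair, and the packaged families -/

section GSide

variable {g : B9.Geometry} [Fintype g.Site] [DecidableEq g.Site] {R : ℝ} {H : Prop} {B : B9.Backgrounds}
variable {X Y ι A P : Type}

/-- ★ **THE SIXTH L² MEMBER OF (3.46) FOR THE SUM G(U) OF (3.107), PER DIRECTION PAIR** — the L² block bound of G∇\*_{U,ν}∇\*_{U,μ}: from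
(3.106) read as G∇\*∇\* = G₀∇\*∇\* + G·(R∇\*∇\*) (`fixedPoint_of_388`; no fixed point in the unknown), the head legs summed with N₃, the
sibling's Schur block bound C·L₀·(Lʲη)² of G (`B9RWSums346Schur.blockBd_entry0` from the pin's sup majorant and the symmetry letter), the
factors summed with N_F, and `comp_l2_transfer` at q = 2: ‖1_{Δ(y)}G∇\*_ν∇\*_μμ‖₂ ≦ `secondConst …`·e^{−(1−2α)δd(y,y′)}‖μ‖₂ for supp μ ⊂ Δ(y′),
provided 2αδ ≦ δ and (1 − 2α)δ ≦ (1 − α₁)δ₁.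
[cite: Balaban1985BackgroundPropagators, Thm 3.10 (3.105)–(3.108) pp.414–416 + (3.46) p.398 + p.413; Balaban1984PropagatorsII, (2.52)–(2.55) p.232 + Lemma 2.1 p.234] -/
theorem l2line5_of_local310 [Fintype X] [DecidableEq X] [Fintype ι] [Fintype A]
    (𝔬 : Ops310 g B X Y ι A) (𝔡 : DirOps310 𝔬 P) (R : ℝ) (H : Prop) (d d₁ : ℕ) (δ α L₀ δ₁ α₁ ρ N N' NF Cℓ N3 B3 θ3 C : ℝ)
    (κ : Sizes310) (S3 : ι → Finset g.Site) (U : B.Cfg)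
    (hNF : 0 ≤ NF) (hN3 : 0 ≤ N3) (hB3 : 0 ≤ B3) (hθ3 : 0 ≤ θ3) (hM : 1 ≤ g.M) (hC : 0 ≤ C)
    (hα2 : 2 * α * δ ≤ δ) (hα₁δ₁ : 0 ≤ α₁ * δ₁) (hrate : (1 - 2 * α) * δ ≤ (1 - α₁) * δ₁)
    (hs : StaticOK310 𝔬 ρ N N' NF Cℓ κ) (hcnt3 : ∀ a : g.Site, (∑ i, if a ∈ S3 i then (1 : ℝ) else 0) ≤ N3)
    (h261 : Ineq261 d₁ (toB6 g R H) δ₁ α₁) (hF : Facts347 g R H d δ α L₀) (hi : Identities310 𝔬 R H U)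
    (hL : L2SecondLegs310 𝔬 𝔡 R H S3 B3 δ₁ U) (hFL : FactorsL2Second310 𝔬 𝔡 R H θ3 δ₁ U)
    (h0 : HasMajorant (g := toB6 g R H) 𝔬.blk (𝔬.G U) (fun (a b : g.Site) => C * g.len a ^ 2 * Real.exp (-(δ * g.dist a b))))
    (hsym : IsTransposePair (𝔬.G U) (𝔬.G U)) (ν μ : P) :
    BlockBd (g := toB6 g R H) 𝔬.blk 𝔬.blk (𝔬.G U ∘ₗ (𝔡.Dsd U ν ∘ₗ 𝔡.Dsd U μ))
      (fun (a b : g.Site) => secondConst d₁ δ₁ α₁ N3 B3 NF θ3 C L₀ * Real.exp (-((1 - 2 * α) * δ * g.dist a b))) := by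
  have hMpos : 0 < g.M := lt_of_lt_of_le one_pos hM
  have hMinv : g.M⁻¹ ≤ 1 := inv_le_one_of_one_le₀ hM
  have hMinv0 : 0 ≤ g.M⁻¹ := inv_nonneg.mpr hMpos.le
  have hlen0 : ∀ y : g.Site, 0 ≤ g.len y := fun y => (hs.lenpos y).le
  have htri : Triangle254 (toB6 g R H) := fun a b c => hs.tri a b c
  have hc1 : 0 ≤ B6.c1 d₁ δ₁ α₁ := c1_nonneg d₁ δ₁ α₁
  have hL₀ : 0 ≤ L₀ := le_trans (le_trans zero_le_one hF.one_le_L) hF.L_le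
  have hρ'0 : 0 ≤ (1 - 2 * α) * δ := by nlinarith [hα2]
  have hexp : ∀ a b : g.Site, Real.exp (-(δ₁ * g.dist a b)) ≤ Real.exp (-((1 - 2 * α) * δ * g.dist a b)) := fun a b =>
    Real.exp_le_exp.mpr (neg_le_neg (mul_le_mul_of_nonneg_right (by nlinarith [hrate, hα₁δ₁]) (hs.dnn a b)))
  -- (3.106)
  have hfix : 𝔬.G U = (∑ i, mulOp (𝔬.h i) * 𝔬.Gsq U i * mulOp (𝔬.h i)) + 𝔬.G U * ∑ a, 𝔬.Rf U a :=
    fixedPoint_of_388 hi.inv hi.eq3105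
  have hsumE : (∑ i, mulOp (𝔬.h i) * 𝔬.Gsq U i * mulOp (𝔬.h i)) ∘ₗ (𝔡.Dsd U ν ∘ₗ 𝔡.Dsd U μ) =
      ∑ i, (mulOp (𝔬.h i) * 𝔬.Gsq U i * mulOp (𝔬.h i)) ∘ₗ (𝔡.Dsd U ν ∘ₗ 𝔡.Dsd U μ) := by
    apply LinearMap.ext
    intro f
    simp only [LinearMap.comp_apply, LinearMap.sum_apply]
  -- the factors R_a∇*∇* summed with N_F
  have hsumF : (∑ a, 𝔬.Rf U a) ∘ₗ (𝔡.Dsd U ν ∘ₗ 𝔡.Dsd U μ) = ∑ a, 𝔬.Rf U a ∘ₗ (𝔡.Dsd U ν ∘ₗ 𝔡.Dsd U μ) := by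
    apply LinearMap.ext
    intro f
    simp only [LinearMap.comp_apply, LinearMap.sum_apply]
  have hP : BlockBd (g := toB6 g R H) 𝔬.blk 𝔬.blk ((∑ a, 𝔬.Rf U a) ∘ₗ (𝔡.Dsd U ν ∘ₗ 𝔡.Dsd U μ))
      (fun (y y' : g.Site) => NF * (θ3 * g.M⁻¹) * g.len y ^ (-(2 : ℝ)) * Real.exp (-(δ₁ * g.dist y y'))) := by
    rw [hsumF]
    have h := blockBd_localSum (R := R) (H := H) 𝔬.blk 𝔬.blk (fun a => 𝔬.Rf U a ∘ₗ (𝔡.Dsd U ν ∘ₗ 𝔡.Dsd U μ))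
      (fun a (y : g.Site) => if y ∈ 𝔬.SF a then (1 : ℝ) else 0)
      (fun (y y' : g.Site) => θ3 * g.M⁻¹ * g.len y ^ (-2 : ℝ) * Real.exp (-(δ₁ * g.dist y y'))) NF
      (fun y y' => mul_nonneg (mul_nonneg (mul_nonneg hθ3 hMinv0) (Real.rpow_nonneg (hlen0 y) _)) (Real.exp_nonneg _))
      (fun a => hFL.facDD a ν μ) hs.cntF
    exact h.mono fun y y' => le_of_eq (by ring)
  -- the L² bound of G by the Schur test of the sibling, as a real power
  have hS0 := blockBd_entry0 hF hC hs.symm hs.lenpos 𝔬.blk h0 hsym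
  have hS : BlockBd (g := toB6 g R H) 𝔬.blk 𝔬.blk (𝔬.G U)
      (fun (a b : g.Site) => C * L₀ * g.len a ^ (2 : ℝ) * Real.exp (-((1 - α) * δ * g.dist a b))) :=
    hS0.mono fun a b => by rw [Real.rpow_two]
  have hρ : (1 - α) * δ = α * δ + (1 - 2 * α) * δ := by ring
  have htail := comp_l2_transfer (R := R) (H := H) 𝔬.blk 𝔬.blk 𝔬.blk hF h261 htri hs.symm hs.dnn hs.lenpos (mul_nonneg hC hL₀)
    (mul_nonneg hNF (mul_nonneg hθ3 hMinv0)) hρ hρ'0 hrate (by rw [abs_two]; norm_num) hS hP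
  have hhead := blockBd_localSum (R := R) (H := H) 𝔬.blk 𝔬.blk
    (fun i => (mulOp (𝔬.h i) * 𝔬.Gsq U i * mulOp (𝔬.h i)) ∘ₗ (𝔡.Dsd U ν ∘ₗ 𝔡.Dsd U μ))
    (fun i (a : g.Site) => if a ∈ S3 i then (1 : ℝ) else 0) (fun (a b : g.Site) => B3 * Real.exp (-(δ₁ * g.dist a b))) N3
    (fun a b => mul_nonneg hB3 (Real.exp_nonneg _)) (fun i => hL.l5 i ν μ) hcnt3
  rw [right_split hfix, hsumE]
  refine (blockBd_add' (R := R) (H := H) 𝔬.blk 𝔬.blk hhead htail).mono fun a b => ?_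
  have hK0 : 0 ≤ N3 * B3 := mul_nonneg hN3 hB3
  have h22 : |(2 : ℝ)| = 2 := abs_two
  have ht : C * L₀ * (NF * (θ3 * g.M⁻¹)) * L₀ ^ |(2 : ℝ)| * B6.c1 d₁ δ₁ α₁ ≤
      C * L₀ * (NF * θ3) * L₀ ^ (2 : ℝ) * B6.c1 d₁ δ₁ α₁ := by
    rw [h22]
    have h3 : θ3 * g.M⁻¹ ≤ θ3 := by
      calc θ3 * g.M⁻¹ ≤ θ3 * 1 := mul_le_mul_of_nonneg_left hMinv hθ3
        _ = θ3 := mul_one _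
    have h4 : C * L₀ * (NF * (θ3 * g.M⁻¹)) ≤ C * L₀ * (NF * θ3) :=
      mul_le_mul_of_nonneg_left (mul_le_mul_of_nonneg_left h3 hNF) (mul_nonneg hC hL₀)
    exact mul_le_mul_of_nonneg_right (mul_le_mul_of_nonneg_right h4 (Real.rpow_nonneg hL₀ _)) hc1
  calc N3 * (B3 * Real.exp (-(δ₁ * g.dist a b))) +
        C * L₀ * (NF * (θ3 * g.M⁻¹)) * L₀ ^ |(2 : ℝ)| * B6.c1 d₁ δ₁ α₁ * Real.exp (-((1 - 2 * α) * δ * g.dist a b))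
      = N3 * B3 * Real.exp (-(δ₁ * g.dist a b)) +
        C * L₀ * (NF * (θ3 * g.M⁻¹)) * L₀ ^ |(2 : ℝ)| * B6.c1 d₁ δ₁ α₁ * Real.exp (-((1 - 2 * α) * δ * g.dist a b)) := by ring
    _ ≤ N3 * B3 * Real.exp (-((1 - 2 * α) * δ * g.dist a b)) +
        C * L₀ * (NF * θ3) * L₀ ^ (2 : ℝ) * B6.c1 d₁ δ₁ α₁ * Real.exp (-((1 - 2 * α) * δ * g.dist a b)) :=
        add_le_add (mul_le_mul_of_nonneg_left (hexp a b) hK0) (mul_le_mul_of_nonneg_right ht (Real.exp_nonneg _))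
    _ = secondConst d₁ δ₁ α₁ N3 B3 NF θ3 C L₀ * Real.exp (-((1 - 2 * α) * δ * g.dist a b)) := by
        unfold secondConst; ring

/-- ★ **THE FOURTH L² MEMBER OF (3.46) FOR THE SUM G(U), PER DIRECTION PAIR, BY ADJOINT TRANSFER** — ∇_{U,ν}∇_{U,μ}G = (G∇\*_{U,μ}∇\*_{U,ν})ᵀ
(G symmetric, ∇\*_κ = ∇_κᵀ: the letters `hsym`, `DirTranspose310`), and an L² block bound passes to the transpose with its arguments
swapped (r1's `B9SectDL2Decay.blockBd_of_adjoint`; the kernel e^{−ρd} is symmetric): ‖1_{Δ(y)}∇_ν∇_μGμ‖₂ ≦ `secondConst …`·e^{−(1−2α)δd}‖μ‖₂.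
[cite: Balaban1985BackgroundPropagators, (3.46) p.398 (fourth member) + p.398 ll.28–31 + p.391; Balaban1984PropagatorsII, (2.52) p.232] -/
theorem l2line3_of_local310 [Fintype X] [DecidableEq X] [Fintype ι] [Fintype A]
    (𝔬 : Ops310 g B X Y ι A) (𝔡 : DirOps310 𝔬 P) (R : ℝ) (H : Prop) (d d₁ : ℕ) (δ α L₀ δ₁ α₁ ρ N N' NF Cℓ N3 B3 θ3 C : ℝ)
    (κ : Sizes310) (S3 : ι → Finset g.Site) (U : B.Cfg)
    (hNF : 0 ≤ NF) (hN3 : 0 ≤ N3) (hB3 : 0 ≤ B3) (hθ3 : 0 ≤ θ3) (hM : 1 ≤ g.M) (hC : 0 ≤ C)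
    (hα2 : 2 * α * δ ≤ δ) (hα₁δ₁ : 0 ≤ α₁ * δ₁) (hrate : (1 - 2 * α) * δ ≤ (1 - α₁) * δ₁)
    (hs : StaticOK310 𝔬 ρ N N' NF Cℓ κ) (hcnt3 : ∀ a : g.Site, (∑ i, if a ∈ S3 i then (1 : ℝ) else 0) ≤ N3)
    (h261 : Ineq261 d₁ (toB6 g R H) δ₁ α₁) (hF : Facts347 g R H d δ α L₀) (hi : Identities310 𝔬 R H U)
    (hL : L2SecondLegs310 𝔬 𝔡 R H S3 B3 δ₁ U) (hFL : FactorsL2Second310 𝔬 𝔡 R H θ3 δ₁ U) (hDT : DirTranspose310 𝔬 𝔡 U)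
    (h0 : HasMajorant (g := toB6 g R H) 𝔬.blk (𝔬.G U) (fun (a b : g.Site) => C * g.len a ^ 2 * Real.exp (-(δ * g.dist a b))))
    (hsym : IsTransposePair (𝔬.G U) (𝔬.G U)) (ν μ : P) :
    BlockBd (g := toB6 g R H) 𝔬.blk 𝔬.blk ((𝔡.Dd U ν ∘ₗ 𝔡.Dd U μ) ∘ₗ 𝔬.G U)
      (fun (a b : g.Site) => secondConst d₁ δ₁ α₁ N3 B3 NF θ3 C L₀ * Real.exp (-((1 - 2 * α) * δ * g.dist a b))) := by
  have h5 := l2line5_of_local310 𝔬 𝔡 R H d d₁ δ α L₀ δ₁ α₁ ρ N N' NF Cℓ N3 B3 θ3 C κ S3 U hNF hN3 hB3 hθ3 hM hC hα2 hα₁δ₁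
    hrate hs hcnt3 h261 hF hi hL hFL h0 hsym μ ν
  have hL₀ : 0 ≤ L₀ := le_trans (le_trans zero_le_one hF.one_le_L) hF.L_le
  have hK : 0 ≤ secondConst d₁ δ₁ α₁ N3 B3 NF θ3 C L₀ := secondConst_nonneg hN3 hB3 hNF hθ3 hC hL₀
  -- (G ∘ ∇*_μ ∘ ∇*_ν)ᵀ = ∇_ν ∘ ∇_μ ∘ G
  have hadj : IsTransposePair (𝔬.G U ∘ₗ (𝔡.Dsd U μ ∘ₗ 𝔡.Dsd U ν)) ((𝔡.Dd U ν ∘ₗ 𝔡.Dd U μ) ∘ₗ 𝔬.G U) :=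
    ((hDT.tr ν).comp (hDT.tr μ)).comp hsym
  have h := blockBd_of_adjoint (g := toB6 g R H) (blk₁ := 𝔬.blk) (blk₂ := 𝔬.blk) (T := (𝔡.Dd U ν ∘ₗ 𝔡.Dd U μ) ∘ₗ 𝔬.G U)
    (T' := 𝔬.G U ∘ₗ (𝔡.Dsd U μ ∘ₗ 𝔡.Dsd U ν)) (fun u w => by
      rw [dotProduct, dotProduct]
      exact (hadj u w).symm) h5 (fun y y' => mul_nonneg hK (Real.exp_nonneg _))
  refine h.mono fun y y' => ?_
  rw [hs.symm y' y]

variable [Fintype P]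

/-- ★ **THE PACKAGED FAMILY G∇\*_{U,ν}∇\*_{U,μ} OVER THE PAIRS (ν, μ) ∈ P × P** has the L² block bound |P|·`secondConst …`·e^{−(1−2α)δd}
between the fibres of `blk` and `blk ∘ fst` (√|P × P| = |P|). [cite: Balaban1985BackgroundPropagators, (3.46) p.398 + (3.39) p.397] -/
theorem blockBd_second_family5 [Fintype X] [DecidableEq X] [Fintype ι] [Fintype A]
    (𝔬 : Ops310 g B X Y ι A) (𝔡 : DirOps310 𝔬 P) (R : ℝ) (H : Prop) (d d₁ : ℕ) (δ α L₀ δ₁ α₁ ρ N N' NF Cℓ N3 B3 θ3 C : ℝ)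
    (κ : Sizes310) (S3 : ι → Finset g.Site) (U : B.Cfg)
    (hNF : 0 ≤ NF) (hN3 : 0 ≤ N3) (hB3 : 0 ≤ B3) (hθ3 : 0 ≤ θ3) (hM : 1 ≤ g.M) (hC : 0 ≤ C)
    (hα2 : 2 * α * δ ≤ δ) (hα₁δ₁ : 0 ≤ α₁ * δ₁) (hrate : (1 - 2 * α) * δ ≤ (1 - α₁) * δ₁)
    (hs : StaticOK310 𝔬 ρ N N' NF Cℓ κ) (hcnt3 : ∀ a : g.Site, (∑ i, if a ∈ S3 i then (1 : ℝ) else 0) ≤ N3)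
    (h261 : Ineq261 d₁ (toB6 g R H) δ₁ α₁) (hF : Facts347 g R H d δ α L₀) (hi : Identities310 𝔬 R H U)
    (hL : L2SecondLegs310 𝔬 𝔡 R H S3 B3 δ₁ U) (hFL : FactorsL2Second310 𝔬 𝔡 R H θ3 δ₁ U)
    (h0 : HasMajorant (g := toB6 g R H) 𝔬.blk (𝔬.G U) (fun (a b : g.Site) => C * g.len a ^ 2 * Real.exp (-(δ * g.dist a b))))
    (hsym : IsTransposePair (𝔬.G U) (𝔬.G U)) :
    BlockBd (g := toB6 g R H) 𝔬.blk (𝔬.blk ∘ Prod.fst)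
      (familyOp fun p : P × P => 𝔬.G U ∘ₗ (𝔡.Dsd U p.1 ∘ₗ 𝔡.Dsd U p.2))
      (fun (a b : g.Site) => (Fintype.card P : ℝ) * secondConst d₁ δ₁ α₁ N3 B3 NF θ3 C L₀ *
        Real.exp (-((1 - 2 * α) * δ * g.dist a b))) := by
  have hL₀ : 0 ≤ L₀ := le_trans (le_trans zero_le_one hF.one_le_L) hF.L_le
  have hK : 0 ≤ secondConst d₁ δ₁ α₁ N3 B3 NF θ3 C L₀ := secondConst_nonneg hN3 hB3 hNF hθ3 hC hL₀
  have h := blockBd_familyOp (R := R) (H := H) 𝔬.blk 𝔬.blk (P := P × P)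
    (T := fun p : P × P => 𝔬.G U ∘ₗ (𝔡.Dsd U p.1 ∘ₗ 𝔡.Dsd U p.2))
    (fun a b => mul_nonneg hK (Real.exp_nonneg _))
    (fun p => l2line5_of_local310 𝔬 𝔡 R H d d₁ δ α L₀ δ₁ α₁ ρ N N' NF Cℓ N3 B3 θ3 C κ S3 U hNF hN3 hB3 hθ3 hM hC hα2 hα₁δ₁
      hrate hs hcnt3 h261 hF hi hL hFL h0 hsym p.1 p.2)
  refine h.mono fun a b => le_of_eq ?_
  rw [Fintype.card_prod, Nat.cast_mul, Real.sqrt_mul_self (Nat.cast_nonneg _)]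
  ring

/-- ★ **THE PACKAGED FAMILY ∇_{U,ν}∇_{U,μ}G OVER THE PAIRS (ν, μ) ∈ P × P** has the L² block bound |P|·`secondConst …`·e^{−(1−2α)δd}
between the fibres of `blk` and `blk ∘ fst`. [cite: Balaban1985BackgroundPropagators, (3.46) p.398 + (3.39) p.397] -/
theorem blockBd_second_family3 [Fintype X] [DecidableEq X] [Fintype ι] [Fintype A]
    (𝔬 : Ops310 g B X Y ι A) (𝔡 : DirOps310 𝔬 P) (R : ℝ) (H : Prop) (d d₁ : ℕ) (δ α L₀ δ₁ α₁ ρ N N' NF Cℓ N3 B3 θ3 C : ℝ)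
    (κ : Sizes310) (S3 : ι → Finset g.Site) (U : B.Cfg)
    (hNF : 0 ≤ NF) (hN3 : 0 ≤ N3) (hB3 : 0 ≤ B3) (hθ3 : 0 ≤ θ3) (hM : 1 ≤ g.M) (hC : 0 ≤ C)
    (hα2 : 2 * α * δ ≤ δ) (hα₁δ₁ : 0 ≤ α₁ * δ₁) (hrate : (1 - 2 * α) * δ ≤ (1 - α₁) * δ₁)
    (hs : StaticOK310 𝔬 ρ N N' NF Cℓ κ) (hcnt3 : ∀ a : g.Site, (∑ i, if a ∈ S3 i then (1 : ℝ) else 0) ≤ N3)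
    (h261 : Ineq261 d₁ (toB6 g R H) δ₁ α₁) (hF : Facts347 g R H d δ α L₀) (hi : Identities310 𝔬 R H U)
    (hL : L2SecondLegs310 𝔬 𝔡 R H S3 B3 δ₁ U) (hFL : FactorsL2Second310 𝔬 𝔡 R H θ3 δ₁ U) (hDT : DirTranspose310 𝔬 𝔡 U)
    (h0 : HasMajorant (g := toB6 g R H) 𝔬.blk (𝔬.G U) (fun (a b : g.Site) => C * g.len a ^ 2 * Real.exp (-(δ * g.dist a b))))
    (hsym : IsTransposePair (𝔬.G U) (𝔬.G U)) :
    BlockBd (g := toB6 g R H) 𝔬.blk (𝔬.blk ∘ Prod.fst)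
      (familyOp fun p : P × P => (𝔡.Dd U p.1 ∘ₗ 𝔡.Dd U p.2) ∘ₗ 𝔬.G U)
      (fun (a b : g.Site) => (Fintype.card P : ℝ) * secondConst d₁ δ₁ α₁ N3 B3 NF θ3 C L₀ *
        Real.exp (-((1 - 2 * α) * δ * g.dist a b))) := by
  have hL₀ : 0 ≤ L₀ := le_trans (le_trans zero_le_one hF.one_le_L) hF.L_le
  have hK : 0 ≤ secondConst d₁ δ₁ α₁ N3 B3 NF θ3 C L₀ := secondConst_nonneg hN3 hB3 hNF hθ3 hC hL₀
  have h := blockBd_familyOp (R := R) (H := H) 𝔬.blk 𝔬.blk (P := P × P)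
    (T := fun p : P × P => (𝔡.Dd U p.1 ∘ₗ 𝔡.Dd U p.2) ∘ₗ 𝔬.G U)
    (fun a b => mul_nonneg hK (Real.exp_nonneg _))
    (fun p => l2line3_of_local310 𝔬 𝔡 R H d d₁ δ α L₀ δ₁ α₁ ρ N N' NF Cℓ N3 B3 θ3 C κ S3 U hNF hN3 hB3 hθ3 hM hC hα2 hα₁δ₁
      hrate hs hcnt3 h261 hF hi hL hFL hDT h0 hsym p.1 p.2)
  refine h.mono fun a b => le_of_eq ?_
  rw [Fintype.card_prod, Nat.cast_mul, Real.sqrt_mul_self (Nat.cast_nonneg _)]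
  ring

end GSide

end

end Literature.MathematicalPhysics.QuantumFieldTheory.Balaban1983to89.B9RWSums346SecondDiff
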